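import Literature.NumberTheory.Sieve.IwaniecAlmostPrimesDispersion
import Literature.NumberTheory.Sieve.IwaniecAlmostPrimesQuadraticRootSlices
import HarnessLib

/-!
# Iwaniec (1978) for a general quadratic `G`: the dispersion identities for `∑_m B(x; m, N)²` — PROVED

H. Iwaniec, *Almost-primes represented by quadratic polynomials*, Invent. Math. **47** (1978)
171–188, §4, proof of Proposition 1 (pp. 181–183), for the sequence `𝒜_G`, `G = aX² + bX + c`;
R. J. Lemke Oliver, Acta Arith. **151** (2012), (2.8)–(2.11) (the same decomposition
`∑_m B(x; m, N)² ≤ ρ(m)·(W − 2xV + x²U)` for a general quadratic).  The general-`G` copy of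
`IwaniecAlmostPrimesDispersion.lean` (twelfth file of the inline proof of `theorem_quadratic`):
pure counting, everything PROVED, no named facts.  It is the first layer of the proof of the
dispersion estimate `proposition1G` (`IwaniecAlmostPrimesQuadraticProp1Corollary.lean`) from
Lemma 4 for `𝒜_G` and the mean value of `ρ_G` in progressions.

* `xcountG a b c X n m v = X_n(m, v) = #{1 ≤ k ≤ X : k ≡ v (m), n ∣ G(k)}`, `ycountG`, `evmG`;
  `congrCountG_mul_eq_sum_xcountG` (`|𝒜_{mn}| = ∑_{v root mod m} X_n(m, v)`, `(m, n) = 1`),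
  `bilinearBG_eq_sum_evmG`, `sq_bilinearBG_le`, `sum_sq_bilinearBG_le` (Cauchy–Schwarz over the
  `ρ_G(m)` roots);
* `tsum2G`, `dispersionG_eq_sum_sum`, `wsumG`, `vsumG`, `usumG`, `tsum2G_eq` — the dispersion identity
  `T(n₁, n₂) = W − x e₂ V(n₁) − x e₁ V(n₂) + x² e₁ e₂ U` (`e_i = ρ_G(n_i)/n_i`);
* the `(l, Θ)` coordinates: `wcountG`, `congrCountG_le_sum_wcountG`, `sum_wcountG_le_congrCountG`,
  `wpairG`, `sum_xcountG_mul_eq_card`, `sum_xcountG_mul_le`, `le_sum_xcountG_mul`.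

The one difference from `n² + 1`: `Θ = 0` can be a root of `G` modulo `D` (when `D ∣ c`), so the
two LOWER sandwiches, whose injections `(l, Θ) ↦ k = Θ + mn⌊l/n⌋` land in `[0, x]` rather than
`[1, x]`, carry the explicit corrections `+ 1` (`sum_wcountG_le_congrCountG`) and `+ 2(X/m + 1)`
(`le_sum_xcountG_mul`, via `card_pairs_Icc_zero_le`); both are `O(x)` in the dispersion and are
absorbed downstream.  The generic interchange lemmas (`card_filter_product_eq_sum`,
`sum_sum_range_comm`, `lt_div_add_one_iff`, …) are the tree's.

## References

* H. Iwaniec, Invent. Math. 47 (1978) 171–188, §4 pp. 181–183 (`IwaniecInventiones1978`).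
* R. J. Lemke Oliver, Acta Arith. 151 (2012) 241–261, (2.8)–(2.11) (`LemkeOliverActaArith2012`).
-/

noncomputable section

open Finset Real

namespace Literature.NumberTheory.Sieve.Iwaniec1978

variable {a b c : ℤ}

/-- `k mod m ≡ k (mod m)` for the integer casts. [folklore] -/
theorem natCast_mod_modEq (k m : ℕ) : ((k % m : ℕ) : ℤ) ≡ (k : ℤ) [ZMOD m] := by
  rw [Int.natCast_mod]; exact Int.mod_modEq _ _

/-! ### The local counts `X_n(m, v)` and the decomposition of `B(x; m, N)` over the roots mod `m` -/

/-- `X_n(m, v) = #{1 ≤ k ≤ X : k ≡ v (mod m), n ∣ k² + 1}` (p. 181, the innermost count in the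
dispersion `W`). [cite: IwaniecInventiones1978, §4 p. 181] -/
def xcountG (a b c : ℤ) (X n m v : ℕ) : ℕ :=
  ((Finset.Icc 1 X).filter (fun k => k % m = v ∧ n ∣ gAbs a b c k)).card

/-- **`|𝒜_{mn}| = ∑_{v root mod m} X_n(m, v)`** for `(m, n) = 1`, `m ≥ 1`: split the `k ≤ x` with
`mn ∣ k² + 1` according to `v = k mod m`, a root of `v² + 1 ≡ 0 (mod m)`.
[cite: IwaniecInventiones1978, §4 p. 181] -/
theorem congrCountG_mul_eq_sum_xcountG (x : ℝ) {m n : ℕ} (hm : 0 < m) (hmn : m.Coprime n) :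
    congrCountG a b c x (m * n) = ∑ v ∈ rootsG a b c m, xcountG a b c ⌊x⌋₊ n m v := by
  classical
  rw [congrCountG_eq]
  set X := ⌊x⌋₊
  have hmaps : ∀ k ∈ (Finset.Icc 1 X).filter (fun k : ℕ => m * n ∣ gAbs a b c k), k % m ∈ rootsG a b c m := by
    intro k hk
    rw [Finset.mem_filter] at hk
    rw [mem_rootsG]
    refine ⟨Nat.mod_lt _ hm, ?_⟩
    have h1 : m ∣ gAbs a b c k := (dvd_mul_right m n).trans hk.2
    exact dvd_quadVal_of_modEq (natCast_mod_modEq k m).symm (dvd_gAbs_iff.1 h1)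
  rw [Finset.card_eq_sum_card_fiberwise hmaps]
  refine Finset.sum_congr rfl fun v hv => ?_
  rw [mem_rootsG] at hv
  unfold xcountG
  rw [Finset.filter_filter]
  congr 1
  refine Finset.filter_congr fun k _ => ?_
  constructor
  · rintro ⟨h1, h2⟩
    exact ⟨h2, (dvd_mul_left n m).trans h1⟩
  · rintro ⟨h1, h2⟩
    refine ⟨hmn.mul_dvd_of_dvd_of_dvd ?_ h2, h1⟩
    have h3 : ((k % m : ℕ) : ℤ) ≡ (k : ℤ) [ZMOD m] := natCast_mod_modEq k m
    rw [h1] at h3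
    exact dvd_gAbs_iff.2 (dvd_quadVal_of_modEq h3 hv.2)

/-- `Y_n(m, v) = X_n(m, v) − (x/m) ρ(n)/n` (p. 181: `X_n` minus its expected value).
[cite: IwaniecInventiones1978, §4 p. 181] -/
def ycountG (a b c : ℤ) (x : ℝ) (n m v : ℕ) : ℝ :=
  (xcountG a b c ⌊x⌋₊ n m v : ℝ) - x * ((rhoG a b c n : ℝ) / n) / m

/-- `E(m, v) = ∑_{n < N, (n,m)=1} b_n Y_n(m, v)`, so that `B(x; m, N) = ∑_{v root mod m} E(m, v)`.
[cite: IwaniecInventiones1978, §4 p. 181] -/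
def evmG (a b c : ℤ) (x : ℝ) (bc : ℕ → ℝ) (N : ℝ) (m v : ℕ) : ℝ :=
  ∑ n ∈ (Finset.Ico 1 ⌈N⌉₊).filter (fun n : ℕ => n.Coprime m), bc n * ycountG a b c x n m v

/-- **`B(x; m, N) = ∑_{v root mod m} E(m, v)`** (`m ≥ 1`). [cite: IwaniecInventiones1978, §4 p. 181] -/
theorem bilinearBG_eq_sum_evmG (x : ℝ) (bc : ℕ → ℝ) (N : ℝ) {m : ℕ} (hm : 0 < m) :
    bilinearBG a b c x bc m N = ∑ v ∈ rootsG a b c m, evmG a b c x bc N m v := by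
  unfold bilinearBG evmG
  rw [Finset.sum_comm]
  refine Finset.sum_congr rfl fun n hn => ?_
  rw [Finset.mem_filter, Finset.mem_Ico] at hn
  have hn0 : 0 < n := hn.1.1
  have hmn : m.Coprime n := hn.2.symm
  rw [← Finset.mul_sum]
  congr 1
  unfold remG ycountG
  rw [Finset.sum_sub_distrib, ← Nat.cast_sum, ← congrCountG_mul_eq_sum_xcountG x hm hmn,
    Finset.sum_const, card_rootsG, nsmul_eq_mul, rhoG_mul_of_coprime hmn]
  have hm0 : (m : ℝ) ≠ 0 := by exact_mod_cast hm.ne'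
  have hn0' : (n : ℝ) ≠ 0 := by exact_mod_cast hn0.ne'
  push_cast
  field_simp

/-- **Cauchy–Schwarz over the roots mod `m`**: `B(x; m, N)² ≤ ρ(m) ∑_v E(m, v)²`.
[cite: IwaniecInventiones1978, §4 p. 181] -/
theorem sq_bilinearBG_le (x : ℝ) (bc : ℕ → ℝ) (N : ℝ) {m : ℕ} (hm : 0 < m) :
    bilinearBG a b c x bc m N ^ 2 ≤ (rhoG a b c m : ℝ) * ∑ v ∈ rootsG a b c m, evmG a b c x bc N m v ^ 2 := by
  rw [bilinearBG_eq_sum_evmG x bc N hm, ← card_rootsG]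
  exact sq_sum_le_card_mul_sum_sq

/-- **`∑_m B(x; m, N)² ≤ T · 𝒟`** where `ρ(m) ≤ T` on the range and
`𝒟 = ∑_m ∑_{v root mod m} E(m, v)²` is the dispersion. [cite: IwaniecInventiones1978, §4 p. 181] -/
theorem sum_sq_bilinearBG_le (x : ℝ) (bc : ℕ → ℝ) (N : ℝ) {Ms : Finset ℕ} (hMs : ∀ m ∈ Ms, 0 < m)
    {T : ℝ} (hT : ∀ m ∈ Ms, (rhoG a b c m : ℝ) ≤ T) :
    ∑ m ∈ Ms, bilinearBG a b c x bc m N ^ 2 ≤ T * ∑ m ∈ Ms, ∑ v ∈ rootsG a b c m, evmG a b c x bc N m v ^ 2 := by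
  rw [Finset.mul_sum]
  refine Finset.sum_le_sum fun m hm => ?_
  refine (sq_bilinearBG_le x bc N (hMs m hm)).trans ?_
  exact mul_le_mul_of_nonneg_right (hT m hm) (Finset.sum_nonneg fun _ _ => sq_nonneg _)

/-! ### Expanding the square: the dispersion as a double sum over `n₁, n₂` -/

/-- `T(n₁, n₂) = ∑_{m, (m, n₁ n₂) = 1} ∑_{v root mod m} Y_{n₁}(m, v) Y_{n₂}(m, v)`.
[cite: IwaniecInventiones1978, §4 p. 181] -/
def tsum2G (a b c : ℤ) (x : ℝ) (Ms : Finset ℕ) (n₁ n₂ : ℕ) : ℝ :=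
  ∑ m ∈ Ms.filter (fun m : ℕ => n₁.Coprime m ∧ n₂.Coprime m),
    ∑ v ∈ rootsG a b c m, ycountG a b c x n₁ m v * ycountG a b c x n₂ m v

/-- **`𝒟 = ∑_{n₁, n₂ < N} b_{n₁} b_{n₂} T(n₁, n₂)`.** [cite: IwaniecInventiones1978, §4 p. 181] -/
theorem dispersionG_eq_sum_sum (x : ℝ) (bc : ℕ → ℝ) (N : ℝ) (Ms : Finset ℕ) :
    ∑ m ∈ Ms, ∑ v ∈ rootsG a b c m, evmG a b c x bc N m v ^ 2 =
      ∑ n₁ ∈ Finset.Ico 1 ⌈N⌉₊, ∑ n₂ ∈ Finset.Ico 1 ⌈N⌉₊, bc n₁ * bc n₂ * tsum2G a b c x Ms n₁ n₂ := by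
  classical
  set Nall := Finset.Ico 1 ⌈N⌉₊ with hNall
  -- expand the square with indicators of the coprimality conditions
  have hsq : ∀ m v, evmG a b c x bc N m v ^ 2 =
      ∑ n₁ ∈ Nall, ∑ n₂ ∈ Nall, (if n₁.Coprime m ∧ n₂.Coprime m then
        bc n₁ * bc n₂ * (ycountG a b c x n₁ m v * ycountG a b c x n₂ m v) else 0) := by
    intro m v
    unfold evmG
    rw [sq, Finset.sum_mul_sum, Finset.sum_filter]
    refine Finset.sum_congr rfl fun n₁ _ => ?_
    rw [Finset.sum_filter]
    by_cases h1 : n₁.Coprime m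
    · rw [if_pos h1]
      refine Finset.sum_congr rfl fun n₂ _ => ?_
      by_cases h2 : n₂.Coprime m
      · rw [if_pos h2, if_pos ⟨h1, h2⟩]; ring
      · rw [if_neg h2, if_neg (fun h => h2 h.2)]
    · rw [if_neg h1]
      symm
      refine Finset.sum_eq_zero fun n₂ _ => ?_
      rw [if_neg (fun h => h1 h.1)]
  set F : ℕ → ℕ → ℕ → ℕ → ℝ := fun m v n₁ n₂ => if n₁.Coprime m ∧ n₂.Coprime m then
        bc n₁ * bc n₂ * (ycountG a b c x n₁ m v * ycountG a b c x n₂ m v) else 0 with hF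
  have hsq' : ∀ m v, evmG a b c x bc N m v ^ 2 = ∑ n₁ ∈ Nall, ∑ n₂ ∈ Nall, F m v n₁ n₂ := hsq
  simp_rw [hsq']
  calc ∑ m ∈ Ms, ∑ v ∈ rootsG a b c m, ∑ n₁ ∈ Nall, ∑ n₂ ∈ Nall, F m v n₁ n₂
      = ∑ m ∈ Ms, ∑ n₁ ∈ Nall, ∑ v ∈ rootsG a b c m, ∑ n₂ ∈ Nall, F m v n₁ n₂ :=
        Finset.sum_congr rfl fun m _ => Finset.sum_comm
    _ = ∑ n₁ ∈ Nall, ∑ m ∈ Ms, ∑ v ∈ rootsG a b c m, ∑ n₂ ∈ Nall, F m v n₁ n₂ := Finset.sum_comm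
    _ = ∑ n₁ ∈ Nall, ∑ m ∈ Ms, ∑ n₂ ∈ Nall, ∑ v ∈ rootsG a b c m, F m v n₁ n₂ :=
        Finset.sum_congr rfl fun n₁ _ => Finset.sum_congr rfl fun m _ => Finset.sum_comm
    _ = ∑ n₁ ∈ Nall, ∑ n₂ ∈ Nall, ∑ m ∈ Ms, ∑ v ∈ rootsG a b c m, F m v n₁ n₂ :=
        Finset.sum_congr rfl fun n₁ _ => Finset.sum_comm
    _ = ∑ n₁ ∈ Nall, ∑ n₂ ∈ Nall, bc n₁ * bc n₂ * tsum2G a b c x Ms n₁ n₂ := by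
        refine Finset.sum_congr rfl fun n₁ _ => Finset.sum_congr rfl fun n₂ _ => ?_
        unfold tsum2G
        rw [Finset.mul_sum, Finset.sum_filter]
        refine Finset.sum_congr rfl fun m _ => ?_
        simp only [hF]
        by_cases hc : n₁.Coprime m ∧ n₂.Coprime m
        · simp only [if_pos hc, Finset.mul_sum]
        · simp only [if_neg hc, Finset.sum_const_zero]

/-! ### `T = W − x e₂ V₁ − x e₁ V₂ + x² e₁ e₂ U` -/

/-- `W(n₁, n₂) = ∑_m ∑_{v root mod m} X_{n₁}(m, v) X_{n₂}(m, v)` (p. 183).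
[cite: IwaniecInventiones1978, §4 p. 183] -/
def wsumG (a b c : ℤ) (X : ℕ) (Msf : Finset ℕ) (n₁ n₂ : ℕ) : ℕ :=
  ∑ m ∈ Msf, ∑ v ∈ rootsG a b c m, xcountG a b c X n₁ m v * xcountG a b c X n₂ m v

/-- `V(n) = ∑_m ∑_{v root mod m} X_n(m, v)/m` (p. 182). [cite: IwaniecInventiones1978, §4 p. 182] -/
def vsumG (a b c : ℤ) (X : ℕ) (Msf : Finset ℕ) (n : ℕ) : ℝ :=
  ∑ m ∈ Msf, ∑ v ∈ rootsG a b c m, (xcountG a b c X n m v : ℝ) / m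

/-- `U = ∑_m ρ(m)/m²` (p. 181). [cite: IwaniecInventiones1978, §4 p. 181] -/
def usumG (a b c : ℤ) (Msf : Finset ℕ) : ℝ := ∑ m ∈ Msf, (rhoG a b c m : ℝ) / (m : ℝ) ^ 2

/-- **The dispersion identity for one pair**: with `e_i = ρ(n_i)/n_i` and the `m`-range restricted
to `(m, n₁) = (m, n₂) = 1`,
`T(n₁, n₂) = W − x e₂ V(n₁) − x e₁ V(n₂) + x² e₁ e₂ U` (p. 181, `𝓜 = W − 2xV + x²U`).
[cite: IwaniecInventiones1978, §4 p. 181] -/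
theorem tsum2G_eq (x : ℝ) (Ms : Finset ℕ) (n₁ n₂ : ℕ) :
    tsum2G a b c x Ms n₁ n₂ =
      (wsumG a b c ⌊x⌋₊ (Ms.filter (fun m : ℕ => n₁.Coprime m ∧ n₂.Coprime m)) n₁ n₂ : ℝ)
        - x * ((rhoG a b c n₂ : ℝ) / n₂) * vsumG a b c ⌊x⌋₊ (Ms.filter (fun m : ℕ => n₁.Coprime m ∧ n₂.Coprime m)) n₁
        - x * ((rhoG a b c n₁ : ℝ) / n₁) * vsumG a b c ⌊x⌋₊ (Ms.filter (fun m : ℕ => n₁.Coprime m ∧ n₂.Coprime m)) n₂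
        + x ^ 2 * ((rhoG a b c n₁ : ℝ) / n₁) * ((rhoG a b c n₂ : ℝ) / n₂) *
          usumG a b c (Ms.filter (fun m : ℕ => n₁.Coprime m ∧ n₂.Coprime m)) := by
  set Msf := Ms.filter (fun m : ℕ => n₁.Coprime m ∧ n₂.Coprime m) with hMsf
  set e₁ : ℝ := (rhoG a b c n₁ : ℝ) / n₁
  set e₂ : ℝ := (rhoG a b c n₂ : ℝ) / n₂
  have hper : ∀ m ∈ Msf, ∑ v ∈ rootsG a b c m, ycountG a b c x n₁ m v * ycountG a b c x n₂ m v =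
      (∑ v ∈ rootsG a b c m, (xcountG a b c ⌊x⌋₊ n₁ m v * xcountG a b c ⌊x⌋₊ n₂ m v : ℕ) : ℝ)
        - x * e₂ * ∑ v ∈ rootsG a b c m, (xcountG a b c ⌊x⌋₊ n₁ m v : ℝ) / m
        - x * e₁ * ∑ v ∈ rootsG a b c m, (xcountG a b c ⌊x⌋₊ n₂ m v : ℝ) / m
        + x ^ 2 * e₁ * e₂ * ((rhoG a b c m : ℝ) / (m : ℝ) ^ 2) := by
    intro m _
    have hterm : ∀ v ∈ rootsG a b c m, ycountG a b c x n₁ m v * ycountG a b c x n₂ m v =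
        ((xcountG a b c ⌊x⌋₊ n₁ m v * xcountG a b c ⌊x⌋₊ n₂ m v : ℕ) : ℝ) - x * e₂ * ((xcountG a b c ⌊x⌋₊ n₁ m v : ℝ) / m)
          - x * e₁ * ((xcountG a b c ⌊x⌋₊ n₂ m v : ℝ) / m) + x ^ 2 * e₁ * e₂ * (1 / (m : ℝ) ^ 2) := by
      intro v _
      unfold ycountG
      push_cast
      ring
    rw [Finset.sum_congr rfl hterm, Finset.sum_add_distrib, Finset.sum_sub_distrib,
      Finset.sum_sub_distrib, ← Finset.mul_sum, ← Finset.mul_sum, ← Finset.mul_sum, Finset.sum_const,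
      card_rootsG, nsmul_eq_mul]
    push_cast
    ring
  unfold tsum2G
  rw [← hMsf, Finset.sum_congr rfl hper, Finset.sum_add_distrib, Finset.sum_sub_distrib,
    Finset.sum_sub_distrib, ← Finset.mul_sum, ← Finset.mul_sum, ← Finset.mul_sum]
  unfold wsumG vsumG usumG
  push_cast
  ring

/-! ### The per-modulus sandwiches: `(l, Θ)` coordinates -/

/-- The window count `#{Θ root mod mn, 0 ≤ Θ < mn : ⌊Θ/m⌋ = c}`
(`= #{Θ : c/n ≤ Θ/(mn) < (c+1)/n}`). [cite: IwaniecInventiones1978, §4 p. 182] -/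
def wcountG (a b c : ℤ) (m n l : ℕ) : ℕ := ((rootsG a b c (m * n)).filter (fun Θ => Θ / m = l)).card

/-- **Upper sandwich for `V`**: `|𝒜_{mn}| ≤ ∑_{0 ≤ l ≤ X/m} #{Θ : ⌊Θ/m⌋ = l mod n}` — every
`k ≤ x` with `mn ∣ k² + 1` is `mn⌊l/n⌋ + Θ` with `l = ⌊k/m⌋ ≤ x/m`, `Θ = k mod mn` a root with
`⌊Θ/m⌋ = l mod n`. [cite: IwaniecInventiones1978, §4 p. 182] -/
theorem congrCountG_le_sum_wcountG (x : ℝ) {m n : ℕ} (hm : 0 < m) (hn : 0 < n) :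
    congrCountG a b c x (m * n) ≤ ∑ l ∈ Finset.range (⌊x⌋₊ / m + 1), wcountG a b c m n (l % n) := by
  classical
  rw [congrCountG_eq]
  set X := ⌊x⌋₊
  have hmn : 0 < m * n := Nat.mul_pos hm hn
  unfold wcountG
  rw [← card_filter_product_eq_sum (Finset.range (X / m + 1)) (rootsG a b c (m * n))
    (fun l Θ => Θ / m = l % n)]
  refine Finset.card_le_card_of_injOn (fun k => (k / m, k % (m * n))) ?_ ?_
  · intro k hk
    rw [Finset.mem_coe, Finset.mem_filter, Finset.mem_Icc] at hk
    rw [Finset.mem_coe, Finset.mem_filter, Finset.mem_product, Finset.mem_range, mem_rootsG]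
    refine ⟨⟨?_, Nat.mod_lt _ hmn, ?_⟩, ?_⟩
    · exact Nat.lt_succ_of_le (Nat.div_le_div_right hk.1.2)
    · exact dvd_quadVal_of_modEq (natCast_mod_modEq k (m * n)).symm
        (by exact_mod_cast dvd_gAbs_iff.1 hk.2)
    · exact Nat.mod_mul_right_div_self k m n
  · intro k hk k' hk' h
    simp only [Prod.mk.injEq] at h
    obtain ⟨h1, h2⟩ := h
    have e1 : k % m = k' % m := by
      rw [← Nat.mod_mod_of_dvd k (dvd_mul_right m n), ← Nat.mod_mod_of_dvd k' (dvd_mul_right m n), h2]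
    rw [← Nat.div_add_mod k m, ← Nat.div_add_mod k' m, h1, e1]

/-- Counting over `[0, X]` instead of `[1, X]` costs at most one. [folklore] -/
theorem card_filter_Icc_zero_le (X : ℕ) (P : ℕ → Prop) [DecidablePred P] :
    ((Finset.Icc 0 X).filter P).card ≤ ((Finset.Icc 1 X).filter P).card + 1 := by
  have h : Finset.Icc 0 X = insert 0 (Finset.Icc 1 X) := by
    ext k; simp only [Finset.mem_Icc, Finset.mem_insert]; omega
  rw [h, Finset.filter_insert]
  split_ifs
  · exact (Finset.card_insert_le _ _)
  · omega

/-- **Lower sandwich for `V`**: `∑_{0 ≤ l < X/m} #{Θ : ⌊Θ/m⌋ = l mod n} ≤ |𝒜_{mn}| + 1` for `m ≥ 1`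
(`(l, Θ) ↦ k = mn⌊l/n⌋ + Θ ∈ [0, x]`; for a general `G` the root `Θ = 0` may occur — when
`mn ∣ c` — and its image `k = 0` is the one point outside `[1, x]`, whence the `+ 1`).
[cite: IwaniecInventiones1978, §4 p. 182] -/
theorem sum_wcountG_le_congrCountG (x : ℝ) {m n : ℕ} (hm : 0 < m) (hn : 0 < n) :
    ∑ l ∈ Finset.range (⌊x⌋₊ / m), wcountG a b c m n (l % n) ≤ congrCountG a b c x (m * n) + 1 := by
  classical
  rw [congrCountG_eq]
  set X := ⌊x⌋₊
  have hmn : 0 < m * n := Nat.mul_pos hm hn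
  refine le_trans ?_ (card_filter_Icc_zero_le X (fun k => m * n ∣ gAbs a b c k))
  unfold wcountG
  rw [← card_filter_product_eq_sum (Finset.range (X / m)) (rootsG a b c (m * n))
    (fun l Θ => Θ / m = l % n)]
  refine Finset.card_le_card_of_injOn (fun p => p.2 + m * n * (p.1 / n)) ?_ ?_
  · intro p hp
    rw [Finset.mem_coe, Finset.mem_filter, Finset.mem_product, Finset.mem_range, mem_rootsG] at hp
    obtain ⟨⟨hl, hΘlt, hΘroot⟩, hdiv⟩ := hp
    rw [Finset.mem_coe, Finset.mem_filter, Finset.mem_Icc]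
    -- `k < m (l + 1) ≤ X`
    have hΘ' : p.2 < m * (p.1 % n) + m := by
      have e := Nat.div_add_mod p.2 m
      have hr := Nat.mod_lt p.2 hm
      rw [hdiv] at e
      omega
    have e1 : m * n * (p.1 / n) + m * (p.1 % n) = m * p.1 := by
      rw [mul_assoc, ← mul_add, Nat.div_add_mod]
    have hkX : p.2 + m * n * (p.1 / n) ≤ X := by
      have h1 : p.2 + m * n * (p.1 / n) < m * (p.1 + 1) := by
        calc p.2 + m * n * (p.1 / n) < (m * (p.1 % n) + m) + m * n * (p.1 / n) :=
              Nat.add_lt_add_right hΘ' _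
          _ = m * (p.1 + 1) := by linarith [e1]
      have hl' : p.1 + 1 ≤ X / m := hl
      calc p.2 + m * n * (p.1 / n) ≤ m * (p.1 + 1) := h1.le
        _ ≤ m * (X / m) := Nat.mul_le_mul_left m hl'
        _ ≤ X := Nat.mul_div_le X m
    refine ⟨⟨Nat.zero_le _, hkX⟩, ?_⟩
    -- root modulo `mn`
    have hmod : (p.2 + m * n * (p.1 / n)) % (m * n) = p.2 % (m * n) := Nat.add_mul_mod_self_left _ _ _
    rw [Nat.mod_eq_of_lt hΘlt] at hmod
    refine dvd_gAbs_iff.2 (dvd_quadVal_of_modEq ?_ hΘroot)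
    have := natCast_mod_modEq (p.2 + m * n * (p.1 / n)) (m * n)
    rw [hmod] at this
    exact_mod_cast this
  · intro p hp p' hp' h
    rw [Finset.mem_coe, Finset.mem_filter, Finset.mem_product, Finset.mem_range, mem_rootsG] at hp hp'
    simp only at h
    have hΘ : p.2 = p'.2 := by
      have e1 : (p.2 + m * n * (p.1 / n)) % (m * n) = p.2 := by
        rw [Nat.add_mul_mod_self_left, Nat.mod_eq_of_lt hp.1.2.1]
      have e2 : (p'.2 + m * n * (p'.1 / n)) % (m * n) = p'.2 := by
        rw [Nat.add_mul_mod_self_left, Nat.mod_eq_of_lt hp'.1.2.1]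
      rw [← e1, ← e2, h]
    have hq : p.1 / n = p'.1 / n := by
      have e1 : (p.2 + m * n * (p.1 / n)) / (m * n) = p.1 / n := by
        rw [Nat.add_mul_div_left _ _ hmn, Nat.div_eq_of_lt hp.1.2.1, zero_add]
      have e2 : (p'.2 + m * n * (p'.1 / n)) / (m * n) = p'.1 / n := by
        rw [Nat.add_mul_div_left _ _ hmn, Nat.div_eq_of_lt hp'.1.2.1, zero_add]
      rw [← e1, ← e2, h]
    have hl : p.1 = p'.1 := by
      rw [← Nat.div_add_mod p.1 n, ← Nat.div_add_mod p'.1 n, hq, ← hp.2, ← hp'.2, hΘ]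
    exact Prod.ext hl hΘ

/-- The `W`-count for fixed `(l₁, l₂)` and `m`:
`#{v root mod m : n₁ ∣ (v + m l₁)² + 1, n₂ ∣ (v + m l₂)² + 1}` (p. 183, the conditions (19)).
[cite: IwaniecInventiones1978, §4 p. 183] -/
def wpairG (a b c : ℤ) (m n₁ n₂ l₁ l₂ : ℕ) : ℕ :=
  ((rootsG a b c m).filter (fun v => n₁ ∣ gAbs a b c (v + m * l₁) ∧ n₂ ∣ gAbs a b c (v + m * l₂))).card

/-- `∑_v X_{n₁}(m,v) X_{n₂}(m,v)` counts the pairs `(k₁, k₂)` in a common root class mod `m`.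
[folklore] -/
theorem sum_xcountG_mul_eq_card (X m n₁ n₂ : ℕ) :
    ∑ v ∈ rootsG a b c m, xcountG a b c X n₁ m v * xcountG a b c X n₂ m v =
      (((Finset.Icc 1 X) ×ˢ (Finset.Icc 1 X)).filter (fun p : ℕ × ℕ => p.1 % m ∈ rootsG a b c m ∧
        p.2 % m = p.1 % m ∧ n₁ ∣ gAbs a b c p.1 ∧ n₂ ∣ gAbs a b c p.2)).card := by
  classical
  unfold xcountG
  have hprod : ∀ v ∈ rootsG a b c m,
      ((Finset.Icc 1 X).filter (fun k => k % m = v ∧ n₁ ∣ gAbs a b c k)).card *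
        ((Finset.Icc 1 X).filter (fun k => k % m = v ∧ n₂ ∣ gAbs a b c k)).card =
      (((Finset.Icc 1 X).filter (fun k => k % m = v ∧ n₁ ∣ gAbs a b c k)) ×ˢ
        ((Finset.Icc 1 X).filter (fun k => k % m = v ∧ n₂ ∣ gAbs a b c k))).card := by
    intro v _; rw [Finset.card_product]
  rw [Finset.sum_congr rfl hprod, ← Finset.card_biUnion]
  · congr 1
    ext p
    simp only [Finset.mem_biUnion, Finset.mem_product, Finset.mem_filter]
    constructor
    · rintro ⟨v, hv, ⟨h1, h1m, h1n⟩, h2, h2m, h2n⟩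
      exact ⟨⟨h1, h2⟩, h1m ▸ hv, by rw [h2m, h1m], h1n, h2n⟩
    · rintro ⟨⟨h1, h2⟩, hv, h21, h1n, h2n⟩
      exact ⟨p.1 % m, hv, ⟨h1, rfl, h1n⟩, h2, h21, h2n⟩
  · intro v _ v' _ hne
    simp only [Function.onFun]
    rw [Finset.disjoint_left]
    intro q hq hq'
    rw [Finset.mem_product, Finset.mem_filter, Finset.mem_filter] at hq hq'
    exact hne (hq.1.2.1.symm.trans hq'.1.2.1)

/-- **Upper sandwich for `W`**: `∑_v X₁X₂ ≤ ∑_{l₁, l₂ ≤ X/m} wpair(m; l₁, l₂)`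
(`(k₁, k₂) ↦ (⌊k₁/m⌋, ⌊k₂/m⌋, k₁ mod m)`). [cite: IwaniecInventiones1978, §4 p. 183] -/
theorem sum_xcountG_mul_le (X m n₁ n₂ : ℕ) :
    ∑ v ∈ rootsG a b c m, xcountG a b c X n₁ m v * xcountG a b c X n₂ m v ≤
      ∑ l₁ ∈ Finset.range (X / m + 1), ∑ l₂ ∈ Finset.range (X / m + 1), wpairG a b c m n₁ n₂ l₁ l₂ := by
  classical
  rw [sum_xcountG_mul_eq_card]
  unfold wpairG
  rw [← card_filter_product_product_eq_sum (Finset.range (X / m + 1)) (Finset.range (X / m + 1))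
    (rootsG a b c m) (fun l₁ l₂ v => n₁ ∣ gAbs a b c (v + m * l₁) ∧ n₂ ∣ gAbs a b c (v + m * l₂))]
  refine Finset.card_le_card_of_injOn (fun p => ((p.1 / m, p.2 / m), p.1 % m)) ?_ ?_
  · intro p hp
    rw [Finset.mem_coe, Finset.mem_filter, Finset.mem_product, Finset.mem_Icc, Finset.mem_Icc] at hp
    obtain ⟨⟨h1, h2⟩, hv, h21, h1n, h2n⟩ := hp
    rw [Finset.mem_coe, Finset.mem_filter, Finset.mem_product, Finset.mem_product, Finset.mem_range,
      Finset.mem_range]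
    refine ⟨⟨⟨Nat.lt_succ_of_le (Nat.div_le_div_right h1.2),
      Nat.lt_succ_of_le (Nat.div_le_div_right h2.2)⟩, hv⟩, ?_, ?_⟩
    · simp only; rw [Nat.mod_add_div]; exact h1n
    · simp only; rw [← h21, Nat.mod_add_div]; exact h2n
  · intro p hp p' hp' h
    rw [Finset.mem_coe, Finset.mem_filter] at hp hp'
    simp only [Prod.mk.injEq] at h
    obtain ⟨⟨hd1, hd2⟩, hmod⟩ := h
    have e1 : p.1 = p'.1 := by rw [← Nat.mod_add_div p.1 m, ← Nat.mod_add_div p'.1 m, hmod, hd1]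
    have e2 : p.2 = p'.2 := by
      rw [← Nat.mod_add_div p.2 m, ← Nat.mod_add_div p'.2 m, hp.2.2.1, hp'.2.2.1, hmod, hd2]
    exact Prod.ext e1 e2

/-- The pair count over `[0, X]²` exceeds the one over `[1, X]²` by at most the pairs with a zero
coordinate, of which there are at most `2(X/m + 1)` in a common class modulo `m`. [folklore] -/
theorem card_pairs_Icc_zero_le (X m : ℕ) (P : ℕ × ℕ → Prop) [DecidablePred P] :
    (((Finset.Icc 0 X) ×ˢ (Finset.Icc 0 X)).filter (fun p : ℕ × ℕ => p.2 % m = p.1 % m ∧ P p)).card ≤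
      (((Finset.Icc 1 X) ×ˢ (Finset.Icc 1 X)).filter (fun p : ℕ × ℕ => p.2 % m = p.1 % m ∧ P p)).card +
        2 * (X / m + 1) := by
  classical
  set S₀ := ((Finset.Icc 0 X) ×ˢ (Finset.Icc 0 X)).filter (fun p : ℕ × ℕ => p.2 % m = p.1 % m ∧ P p)
    with hS₀
  set S₁ := ((Finset.Icc 1 X) ×ˢ (Finset.Icc 1 X)).filter (fun p : ℕ × ℕ => p.2 % m = p.1 % m ∧ P p)
    with hS₁
  -- split `S₀` according to whether a coordinate vanishes
  have hsplit : S₀ ⊆ S₁ ∪ (S₀.filter (fun p => p.1 = 0) ∪ S₀.filter (fun p => p.2 = 0)) := by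
    intro p hp
    by_cases h1 : p.1 = 0
    · exact Finset.mem_union_right _ (Finset.mem_union_left _ (Finset.mem_filter.mpr ⟨hp, h1⟩))
    by_cases h2 : p.2 = 0
    · exact Finset.mem_union_right _ (Finset.mem_union_right _ (Finset.mem_filter.mpr ⟨hp, h2⟩))
    refine Finset.mem_union_left _ ?_
    simp only [hS₀, hS₁, Finset.mem_filter, Finset.mem_product, Finset.mem_Icc] at hp ⊢
    exact ⟨⟨⟨by omega, hp.1.1.2⟩, by omega, hp.1.2.2⟩, hp.2⟩
  -- the multiples of `m` in `[0, X]`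
  have hmult : ∀ (s : Finset (ℕ × ℕ)) (proj : ℕ × ℕ → ℕ), (∀ p ∈ s, proj p ≤ X ∧ proj p % m = 0) →
      Set.InjOn proj s → s.card ≤ X / m + 1 := by
    intro s proj hπ hinj
    have hmaps : Set.MapsTo proj s ((Finset.range (X / m + 1)).image (fun t => m * t)) := by
      intro p hp
      obtain ⟨hle, hmod⟩ := hπ p hp
      rw [Finset.coe_image, Finset.coe_range]
      refine ⟨proj p / m, ?_, ?_⟩
      · rw [Set.mem_Iio, Nat.lt_succ_iff]
        exact Nat.div_le_div_right hle
      · exact Nat.mul_div_cancel' (Nat.dvd_of_mod_eq_zero hmod)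
    calc s.card ≤ ((Finset.range (X / m + 1)).image (fun t => m * t)).card :=
          Finset.card_le_card_of_injOn proj hmaps hinj
      _ ≤ (Finset.range (X / m + 1)).card := Finset.card_image_le
      _ = X / m + 1 := Finset.card_range _
  have hA : (S₀.filter (fun p => p.1 = 0)).card ≤ X / m + 1 := by
    refine hmult _ (fun p => p.2) ?_ ?_
    · intro p hp
      rw [Finset.mem_filter, hS₀, Finset.mem_filter, Finset.mem_product, Finset.mem_Icc,
        Finset.mem_Icc] at hp
      obtain ⟨⟨⟨-, h2⟩, hmod, -⟩, h0⟩ := hp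
      refine ⟨h2.2, ?_⟩
      rw [hmod, h0, Nat.zero_mod]
    · intro p hp p' hp' h
      rw [Finset.coe_filter] at hp hp'
      exact Prod.ext (hp.2.trans hp'.2.symm) h
  have hB : (S₀.filter (fun p => p.2 = 0)).card ≤ X / m + 1 := by
    refine hmult _ (fun p => p.1) ?_ ?_
    · intro p hp
      rw [Finset.mem_filter, hS₀, Finset.mem_filter, Finset.mem_product, Finset.mem_Icc,
        Finset.mem_Icc] at hp
      obtain ⟨⟨⟨h1, -⟩, hmod, -⟩, h0⟩ := hp
      refine ⟨h1.2, ?_⟩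
      rw [← hmod, h0, Nat.zero_mod]
    · intro p hp p' hp' h
      rw [Finset.coe_filter] at hp hp'
      exact Prod.ext h (hp.2.trans hp'.2.symm)
  calc S₀.card ≤ (S₁ ∪ (S₀.filter (fun p => p.1 = 0) ∪ S₀.filter (fun p => p.2 = 0))).card :=
        Finset.card_le_card hsplit
    _ ≤ S₁.card + ((S₀.filter (fun p => p.1 = 0)).card + (S₀.filter (fun p => p.2 = 0)).card) :=
        (Finset.card_union_le _ _).trans (add_le_add le_rfl (Finset.card_union_le _ _))
    _ ≤ S₁.card + 2 * (X / m + 1) := by omega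

/-- **Lower sandwich for `W`** (`m ≥ 1`):
`∑_{l₁, l₂ < X/m} wpair(m; l₁, l₂) ≤ ∑_v X₁X₂ + 2(X/m + 1)` (`(l₁, l₂, v) ↦ (v + m l₁, v + m l₂)`
maps into the pairs over `[0, X]²`; for a general `G` the root `v = 0` may occur, and the pairs
with a zero coordinate are the correction). [cite: IwaniecInventiones1978, §4 p. 183] -/
theorem le_sum_xcountG_mul (X : ℕ) {m : ℕ} (hm : 0 < m) (n₁ n₂ : ℕ) :
    ∑ l₁ ∈ Finset.range (X / m), ∑ l₂ ∈ Finset.range (X / m), wpairG a b c m n₁ n₂ l₁ l₂ ≤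
      ∑ v ∈ rootsG a b c m, xcountG a b c X n₁ m v * xcountG a b c X n₂ m v + 2 * (X / m + 1) := by
  classical
  rw [sum_xcountG_mul_eq_card]
  -- compare with the pairs over `[0, X]²`
  have hcmp := card_pairs_Icc_zero_le X m
    (fun p : ℕ × ℕ => p.1 % m ∈ rootsG a b c m ∧ n₁ ∣ gAbs a b c p.1 ∧ n₂ ∣ gAbs a b c p.2)
  have hrew : ∀ (s : Finset (ℕ × ℕ)), s.filter (fun p : ℕ × ℕ => p.1 % m ∈ rootsG a b c m ∧
      p.2 % m = p.1 % m ∧ n₁ ∣ gAbs a b c p.1 ∧ n₂ ∣ gAbs a b c p.2) =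
      s.filter (fun p : ℕ × ℕ => p.2 % m = p.1 % m ∧ (p.1 % m ∈ rootsG a b c m ∧
        n₁ ∣ gAbs a b c p.1 ∧ n₂ ∣ gAbs a b c p.2)) := by
    intro s; refine Finset.filter_congr fun p _ => ?_; tauto
  rw [hrew]
  refine le_trans ?_ hcmp
  rw [← hrew (Finset.Icc 0 X ×ˢ Finset.Icc 0 X)]
  unfold wpairG
  rw [← card_filter_product_product_eq_sum (Finset.range (X / m)) (Finset.range (X / m))
    (rootsG a b c m) (fun l₁ l₂ v => n₁ ∣ gAbs a b c (v + m * l₁) ∧ n₂ ∣ gAbs a b c (v + m * l₂))]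
  refine Finset.card_le_card_of_injOn (fun t => (t.2 + m * t.1.1, t.2 + m * t.1.2)) ?_ ?_
  · intro t ht
    rw [Finset.mem_coe, Finset.mem_filter, Finset.mem_product, Finset.mem_product, Finset.mem_range,
      Finset.mem_range, mem_rootsG] at ht
    obtain ⟨⟨⟨hl1, hl2⟩, hvlt, hvroot⟩, h1n, h2n⟩ := ht
    have hbound : ∀ l, l < X / m → t.2 + m * l ≤ X := by
      intro l hl
      have hl' : l + 1 ≤ X / m := hl
      calc t.2 + m * l ≤ m + m * l := by omega
        _ = m * (l + 1) := by ring
        _ ≤ m * (X / m) := Nat.mul_le_mul_left m hl'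
        _ ≤ X := Nat.mul_div_le X m
    have hmod : ∀ l, (t.2 + m * l) % m = t.2 := by
      intro l; rw [Nat.add_mul_mod_self_left, Nat.mod_eq_of_lt hvlt]
    rw [Finset.mem_coe, Finset.mem_filter, Finset.mem_product, Finset.mem_Icc, Finset.mem_Icc]
    simp only
    refine ⟨⟨⟨Nat.zero_le _, hbound _ hl1⟩, ⟨Nat.zero_le _, hbound _ hl2⟩⟩, ?_, ?_, h1n, h2n⟩
    · rw [hmod, mem_rootsG]; exact ⟨hvlt, hvroot⟩
    · rw [hmod, hmod]
  · intro t ht t' ht' h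
    rw [Finset.mem_coe, Finset.mem_filter, Finset.mem_product, Finset.mem_product, Finset.mem_range,
      Finset.mem_range, mem_rootsG] at ht ht'
    simp only [Prod.mk.injEq] at h
    obtain ⟨h1, h2⟩ := h
    have hv : t.2 = t'.2 := by
      have e := congrArg (· % m) h1
      simp only [Nat.add_mul_mod_self_left, Nat.mod_eq_of_lt ht.1.2.1,
        Nat.mod_eq_of_lt ht'.1.2.1] at e
      exact e
    rw [hv] at h1 h2
    have hl1 : t.1.1 = t'.1.1 := Nat.eq_of_mul_eq_mul_left hm (Nat.add_left_cancel h1)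
    have hl2 : t.1.2 = t'.1.2 := Nat.eq_of_mul_eq_mul_left hm (Nat.add_left_cancel h2)
    exact Prod.ext (Prod.ext hl1 hl2) hv


end Literature.NumberTheory.Sieve.Iwaniec1978

end
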